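import Summits.QuantumFields.BalabanUV.T4Continuum.Support.SpreadLiftMap
import Summits.QuantumFields.BalabanUV.T4Continuum.Support.AveragingDeficitLiftPeriodic

/-!
# SpreadLift (T⁴ programme, node NE3, crew row S6-Y7 (c) `replicationRightInverse`, file 4/6) — THE ONE-LEVEL RIGHT INVERSE OF
# THE DIFFERENTIAL OF BAŁABAN'S AVERAGE (42): an EXPLICIT ℝ-LINEAR LOCAL map `Q_V` of coarse `𝔤𝔩(N)`-valued bond fields to
# fine ones with `pushDir L V (Q_V φ) (Ly, κ) = φ(y, κ)` EXACTLY, supported on the crossing bonds, `‖Q_V φ (b)‖ ≤ (1 + 128dL²a)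
# ‖φ(c(b))‖` (L-UNIFORM), `𝔲(N)`-valued for `𝔲(N)` data, periodic for periodic data, and the period sums with the EXACT volume
# factor `L^{d−1}` — under the tree's STANDARD smallness `512(d+1)(d+4)L²a ≤ 1` (no `L^{d+2}`)

HONEST FRAMING (cell `pub-balaban`, T4-DAG PAGE 1; unit `b2b-balaban-t4-ne3-formalise-leaf-01` gen 3, NE3 (node U1b)
formalisation swarm, crew sub-row **S6-Y7 (c)** of `t4/formal/NE3/LEAVES.md` = leaf **L7(c) `replicationRightInverse`** of
the road-P3 skeleton `t4/skeletons/NE3-t4-ne3-p3.md` §2: «an explicit linear `Q_R` with `d(avgIter k)_U ∘ Q_R = id` on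
unit-lattice `𝔲(N)` fields, bounded sup→sup, ℓ¹→ℓ¹, ℓ²→ℓ²»; consumed by P3 §1 (E0) and §0.4 T-LIP).  The cell's T4 target is
the finite-torus continuum limit of the unit-scale averaged loop expectations — NOT infinite volume, NO mass gap, NOT Clay,
NOT summit progress.  THIS FILE is the ONE-LEVEL statement (file 5 climbs the tower), all [folklore], 0 sorry: §1 the
standard smallness gives the loop bound `loopRad = 16(d+1)(d+4)L²a ≤ 1/32` (`B7Prop2Explicit.norm_Wcx_sub_one_le` BY NAME) and
`128dL²a ≤ 1`; §2 **`spreadInverse`** `:= spreadLift ∘ (bondwise spreadInv)` as a `LinearMap`, with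
**`pushDir_spreadInverse`** (EXACT right inverse), `crossSupported_spreadInverse`, **`norm_spreadInverse_le`**
(`≤ (1 + 128dL²a)‖φ(⌊z/L⌋, i)‖` pointwise), `norm_spreadInverse_sub_spreadLift_le` (the inverse IS the plain covariant
replication up to `128dL²a`), `isSkewDir_spreadInverse`, locality `spreadInverse_congr`; §3 periodicity
(`isPeriodicDir_spreadInverse`: `V` of period `L·M`, `φ` of period `M` ⇒ `Q_V φ` of period `L·M`); §4 PERIOD SUMS:
`Σ_{z ∈ [0,LM)^d, i} ‖Q_V φ (z,i)‖ ≤ (1 + 128dL²a)·L^{d−1}·Σ_{y ∈ [0,M)^d, i} ‖φ(y,i)‖` and the same for squares with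
`(1 + 128dL²a)²` — the EXACT volume factor `L^{d−1}` (= number of crossing bonds per coarse bond), stated, not hidden.
CURRENCY NOTE (honest, for the assembler of P3 (E0)): ANY right inverse has `Σ_fine ‖ψ‖ ≥ c·L^{d−1}·Σ_coarse ‖φ‖` per level
(each of the `L^d` contours of `c` must collect `φ(c)` and each fine bond lies on at most `L` of them), so an `ℓ¹→ℓ¹` bound
uniform in the number of levels holds in VOLUME-WEIGHTED `ℓ¹` (sums × `L^{−(d−1)}` per level), not in counting sums.
NOT NE3 in disguise: linear algebra of ONE averaging operator at ONE background; no minimiser, no two-spacing comparison, no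
rate, no energy norm (ρ19 clean).  NE3 is NOT proved by this file.
CITATION HEADER: no printed sentence is a hypothesis; the manuscripts under audit are not cited for any disputed step;
context: T. Bałaban, Commun. Math. Phys. **98** (1985) 17–51 [Balaban1985Averaging] ((42) p. 23, (44)–(45) p. 24, p. 25,
(139)–(147) p. 39–40 «`|Q_k(U₀; c, b)| ≤ 1 + 2C′₁α₀`»); **102** (1985) 277–309 [Balaban1985Variational] ((75)–(76) p. 289,
(83) p. 290: the constraints whose differential is inverted).
PLACEMENT: `Summits/QuantumFields/BalabanUV/` (human rule 2026-08-19).  Record: HOME `t4/formal/NE3/LEAVES.md` row S5∕S6.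
-/

set_option autoImplicit false

open scoped BigOperators Matrix Matrix.Norms.L2Operator Topology
open NormedSpace Finset Filter

namespace Summit.QuantumFields.BalabanUV.T4Continuum.SpreadLift

open Literature.MathematicalPhysics.QuantumFieldTheory.Balaban1983to89
open B7Prop1Explicit B7Prop2Explicit MatrixLog UnitaryModel
open T4AveragingDeficitWall hiding Site Plane Plaq Bond
open T4AveragingDeficitWallBoundary (IsPeriodicCfg periodBox blockSites_periodBox sum_blocks_eq)
open T4AveragingDeficitNonAbelian (Ad_mul Ad_sub)
open AveragingDeficitTransport AveragingDeficitLocality AveragingDeficitNearIdentity AveragingDeficitSideDeriv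
open AveragingDeficitResidualPairing AveragingDeficitTransportCalc AveragingDeficitPushForwardLinear
open AveragingDeficitPeriodicCounting (IsPeriodicDir natCast_mul_period)
open AveragingDeficitFaceWords (faceSite boxVec_bounds)
open AveragingDeficitLiftMap (bondDir bondDir_self LoopBound)
open AveragingDeficitLiftPeriodic (shiftDir shiftDir_apply_add hol_shift pushDir_shift)
open SkeletonLattice (cdiv cmod cdiv_add_period cmod_add_period)
open SpreadLiftWords SpreadLiftDirection SpreadLiftMap

noncomputable section

variable {d : ℕ} {n : Type*} [Fintype n] [DecidableEq n]

/-! ## §1 The standard smallness gives the loop bound and the inversion regime -/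

/-- The loop-bound radius `16(d+1)(d+4)L²a` of the standard smallness (B7 p. 25 via `norm_Wcx_sub_one_le`). [folklore] -/
def loopRad (d L : ℕ) (a : ℝ) : ℝ := 2 * (8 * ((d : ℝ) + 1) * ((d : ℝ) + 4) * (L : ℝ) ^ 2 * a)

omit [Fintype n] [DecidableEq n] in
/-- `512(d+1)(d+4)L²a ≤ 1 ⇒ loopRad ≤ 1/32`. [folklore] -/
theorem loopRad_le {L : ℕ} {a : ℝ} (h512 : 512 * (d + 1) * (d + 4) * (L : ℝ) ^ 2 * a ≤ 1) : loopRad d L a ≤ 1 / 32 := by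
  unfold loopRad; linarith

omit [Fintype n] [DecidableEq n] in
/-- `512(d+1)(d+4)L²a ≤ 1 ⇒ 128·d·L²·a ≤ 1` (the inversion regime of file 3). [folklore] -/
theorem small128_of_small512 {L : ℕ} {a : ℝ} (ha : 0 ≤ a) (h512 : 512 * (d + 1) * (d + 4) * (L : ℝ) ^ 2 * a ≤ 1) :
    128 * (d * (L : ℝ) ^ 2 * a) ≤ 1 := by
  have hd0 : (0 : ℝ) ≤ d := Nat.cast_nonneg d
  have h0 : 0 ≤ (L : ℝ) ^ 2 * a := by positivity
  nlinarith

/-- **THE LOOP BOUND everywhere** from the standard smallness: `|V(Γ_{c,x})V(c)⁻¹ − 1| ≤ loopRad`.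
[cite: Balaban1985Averaging, p.25] -/
theorem loopBound_of_smallField [Nonempty n] {L : ℕ} (hL : 1 ≤ L) {V : Site d → Fin d → (Matrix n n ℂ)ˣ}
    (hV : IsUnitaryCfg V) {a : ℝ} (ha : 0 ≤ a) (h512 : 512 * (d + 1) * (d + 4) * (L : ℝ) ^ 2 * a ≤ 1)
    (hVa : SmallField V a) (y : Site d) (κ : Fin d) : LoopBound L V y κ (loopRad d L a) := fun r =>
  norm_Wcx_sub_one_le L hL V (fun x μ => mem_U1_of_unitary (hV x μ)) ha h512 hVa _ κ r

/-! ## §2 The one-level right inverse -/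

section Inverse

variable [Nonempty n] {L : ℕ} (hL : 1 ≤ L) {V : Site d → Fin d → (Matrix n n ℂ)ˣ} (hV : IsUnitaryCfg V) {a : ℝ}
  (ha : 0 ≤ a) (h512 : 512 * (d + 1) * (d + 4) * (L : ℝ) ^ 2 * a ≤ 1) (hVa : SmallField V a)

/-- The BONDWISE-INVERTED coarse data: `(M_c⁻¹ φ(c))_c`. [folklore] -/
def invData (φ : Site d → Fin d → Matrix n n ℂ) : Site d → Fin d → Matrix n n ℂ := fun y κ =>
  spreadInv hL hV ha hVa (small128_of_small512 ha h512) y κ (loopRad_le h512) (loopBound_of_smallField hL hV ha h512 hVa y κ)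
    (φ y κ)

/-- `invData` is additive. [folklore] -/
theorem invData_add (φ φ' : Site d → Fin d → Matrix n n ℂ) :
    invData hL hV ha h512 hVa (φ + φ') = invData hL hV ha h512 hVa φ + invData hL hV ha h512 hVa φ' := by
  funext y κ; simp only [invData, Pi.add_apply, map_add]

/-- `invData` is real-homogeneous. [folklore] -/
theorem invData_smul (c : ℝ) (φ : Site d → Fin d → Matrix n n ℂ) :
    invData hL hV ha h512 hVa (c • φ) = c • invData hL hV ha h512 hVa φ := by
  funext y κ; simp only [invData, Pi.smul_apply, map_smul]

/-- **THE ONE-LEVEL RIGHT INVERSE `Q_V` OF THE DIFFERENTIAL OF (42)**: `φ ↦ spreadLift L V (M⁻¹ φ)` — the covariant replication on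
the crossing bonds of the bondwise-inverted data; an explicit `ℝ`-linear map. [cite: Balaban1985Averaging, (42) p.23, (139)–(147) p.39–40] -/
def spreadInverse : (Site d → Fin d → Matrix n n ℂ) →ₗ[ℝ] (Site d → Fin d → Matrix n n ℂ) where
  toFun φ := spreadLift L V (invData hL hV ha h512 hVa φ)
  map_add' φ φ' := by simp only [invData_add, spreadLift_add]
  map_smul' c φ := by simp only [invData_smul, spreadLift_smul, RingHom.id_apply]

/-- `spreadInverse` unfolds. [folklore] -/
theorem spreadInverse_apply (φ : Site d → Fin d → Matrix n n ℂ) :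
    spreadInverse hL hV ha h512 hVa φ = spreadLift L V (invData hL hV ha h512 hVa φ) := rfl

/-- **EXACT RIGHT INVERSE**: `pushDir L V (Q_V φ) (Ly, κ) = φ(y, κ)` for EVERY coarse bond and every coarse datum `φ`.
[cite: Balaban1985Averaging, (42) p.23; Balaban1985Variational, (83) p.290] -/
theorem pushDir_spreadInverse (φ : Site d → Fin d → Matrix n n ℂ) (y : Site d) (κ : Fin d) :
    pushDir L V (spreadInverse hL hV ha h512 hVa φ) ((L : ℤ) • y) κ = φ y κ := by
  rw [spreadInverse_apply, pushDir_spreadLift hL V y κ (loopRad_le h512) (loopBound_of_smallField hL hV ha h512 hVa y κ)]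
  exact spreadMap_spreadInv hL hV ha hVa _ y κ _ _ (φ y κ)

/-- SUPPORT: `Q_V φ` vanishes off the crossing bonds. [folklore] -/
theorem crossSupported_spreadInverse (φ : Site d → Fin d → Matrix n n ℂ) :
    CrossSupported L (spreadInverse hL hV ha h512 hVa φ) :=
  crossSupported_spreadLift L V _

/-- **THE POINTWISE BOUND (L-UNIFORM)**: `‖Q_V φ (z, i)‖ ≤ (1 + 128dL²a)·‖φ(⌊z/L⌋, i)‖`. [cite: Balaban1985Averaging, (139)–(147) p.39–40] -/
theorem norm_spreadInverse_le (φ : Site d → Fin d → Matrix n n ℂ) (z : Site d) (i : Fin d) :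
    ‖spreadInverse hL hV ha h512 hVa φ z i‖ ≤ (1 + 128 * (d * (L : ℝ) ^ 2 * a)) * ‖φ (cdiv L z) i‖ := by
  rw [spreadInverse_apply]
  refine (norm_spreadLift_le L hV _ z i).trans ?_
  exact (norm_spreadInv_le hL hV ha hVa _ _ i _ _ _).1

/-- On a crossing bond the norm is exactly that of the inverted datum, hence at least `‖φ(c)‖·(1 − 128dL²a)`-sized and at most
`(1 + 128dL²a)‖φ(c)‖`; off the crossing bonds it is `0`. [folklore] -/
theorem norm_spreadInverse_of_isCross (φ : Site d → Fin d → Matrix n n ℂ) {z : Site d} {i : Fin d} (h : IsCross L z i) :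
    ‖spreadInverse hL hV ha h512 hVa φ z i‖ = ‖invData hL hV ha h512 hVa φ (cdiv L z) i‖ := by
  rw [spreadInverse_apply, norm_spreadLift_of_isCross L hV _ h]

/-- **THE INVERSE IS THE PLAIN COVARIANT REPLICATION UP TO `O(dL²a)`**: `‖Q_V φ (z,i) − spreadLift φ (z,i)‖ ≤ 128dL²a·‖φ(⌊z/L⌋, i)‖`.
[folklore] -/
theorem norm_spreadInverse_sub_spreadLift_le (φ : Site d → Fin d → Matrix n n ℂ) (z : Site d) (i : Fin d) :
    ‖spreadInverse hL hV ha h512 hVa φ z i - spreadLift L V φ z i‖ ≤ 128 * (d * (L : ℝ) ^ 2 * a) * ‖φ (cdiv L z) i‖ := by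
  rw [spreadInverse_apply, ← Pi.sub_apply, ← Pi.sub_apply (f := spreadLift L V _), ← spreadLift_smul_sub]
  · refine (norm_spreadLift_le L hV _ z i).trans ?_
    exact (norm_spreadInv_le hL hV ha hVa _ _ i _ _ _).2
  where
  /-- `spreadLift` is subtractive in the data (from additivity and homogeneity). [folklore] -/
  spreadLift_smul_sub : ∀ (φ φ' : Site d → Fin d → Matrix n n ℂ),
      spreadLift L V (φ - φ') = spreadLift L V φ - spreadLift L V φ' := fun φ φ' => by
    rw [sub_eq_add_neg, spreadLift_add, ← neg_one_smul ℝ φ', spreadLift_smul, neg_one_smul, ← sub_eq_add_neg]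

/-- `𝔲(N)` data give a `𝔲(N)` direction. [folklore] -/
theorem isSkewDir_spreadInverse {φ : Site d → Fin d → Matrix n n ℂ} (hφ : ∀ y κ, φ y κ ∈ skewAdjoint (Matrix n n ℂ)) :
    IsSkewDir (spreadInverse hL hV ha h512 hVa φ) := by
  rw [spreadInverse_apply]
  exact isSkewDir_spreadLift L hV fun y κ => spreadInv_mem_skew hL hV ha hVa _ y κ _ _ (hφ y κ)

/-- LOCALITY: `Q_V φ (z, i)` depends on `φ` only through `φ(⌊z/L⌋, i)`. [folklore] -/
theorem spreadInverse_congr {φ φ' : Site d → Fin d → Matrix n n ℂ} {z : Site d} {i : Fin d}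
    (h : φ (cdiv L z) i = φ' (cdiv L z) i) :
    spreadInverse hL hV ha h512 hVa φ z i = spreadInverse hL hV ha h512 hVa φ' z i := by
  rw [spreadInverse_apply, spreadInverse_apply]
  refine spreadLift_congr L V ?_
  simp only [invData, h]

/-! ## §3 Periodicity -/

include hL in
omit [Nonempty n] in
/-- The spread lift of the one-bond data of a translated coarse bond is the translated spread lift (for `L•v`-invariant `V`).
[folklore] -/
theorem spreadLift_bondDir_shift (y v : Site d) (κ : Fin d) (m : Matrix n n ℂ)
    (hVv : ∀ (x : Site d) (μ : Fin d), V (x + (L : ℤ) • v) μ = V x μ) :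
    spreadLift L V (bondDir (y + v) κ m) = shiftDir ((L : ℤ) • v) (spreadLift L V (bondDir y κ m)) := by
  funext z i
  -- crossing and coarse coordinates under the shift by `L•v`
  have hcross : IsCross L z i ↔ IsCross L (z - (L : ℤ) • v) i := by
    unfold IsCross cmod
    simp only [Pi.sub_apply, Pi.smul_apply, smul_eq_mul]
    rw [show z i - (L : ℤ) * v i = z i + (-(v i)) * (L : ℤ) by ring, Int.add_mul_emod_self_right]
  have hcdiv : cdiv L (z - (L : ℤ) • v) = cdiv L z - v := by
    funext j
    have hL0 : (L : ℤ) ≠ 0 := by exact_mod_cast (by omega : L ≠ 0)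
    simp only [cdiv, Pi.sub_apply, Pi.smul_apply, smul_eq_mul]
    rw [show z j - (L : ℤ) * v j = z j + (-(v j)) * (L : ℤ) by ring, Int.add_mul_ediv_right _ _ hL0]
    ring
  simp only [shiftDir, spreadLift]
  by_cases hc : IsCross L z i
  · have hc' : IsCross L (z - (L : ℤ) • v) i := hcross.mp hc
    rw [if_pos hc, if_pos hc']
    have hb : bondDir (y + v) κ m (cdiv L z) i = bondDir y κ m (cdiv L (z - (L : ℤ) • v)) i := by
      rw [hcdiv]
      simp only [bondDir, sub_eq_iff_eq_add]
    rw [hb]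
    congr 2
    -- the transports agree: corners and end points are translated by `L•v`, `V` is invariant
    unfold crossHol exitCorner
    rw [hcdiv, show (L : ℤ) • (cdiv L z - v + e i) = (L : ℤ) • (cdiv L z + e i) - (L : ℤ) • v by
        rw [smul_add, smul_sub, smul_add]; abel,
      show z - (L : ℤ) • v + e i - ((L : ℤ) • (cdiv L z + e i) - (L : ℤ) • v) = z + e i - (L : ℤ) • (cdiv L z + e i) by abel]
    have := hol_shift (W := V) (W' := V) (t := (L : ℤ) • v) hVv (treeWord (z + e i - (L : ℤ) • (cdiv L z + e i)))
      ((L : ℤ) • (cdiv L z + e i) - (L : ℤ) • v)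
    rw [sub_add_cancel] at this
    exact this
  · have hc' : ¬ IsCross L (z - (L : ℤ) • v) i := fun h => hc (hcross.mpr h)
    rw [if_neg hc, if_neg hc']

include hL in
omit [Nonempty n] in
/-- **THE LIFT MAPS OF `c` AND `c + v` COINCIDE** for `L•v`-invariant `V` (as functions). [folklore] -/
theorem spreadMap_shift (y v : Site d) (κ : Fin d) (hVv : ∀ (x : Site d) (μ : Fin d), V (x + (L : ℤ) • v) μ = V x μ)
    {w : ℝ} (hw : w ≤ 1 / 32) (hW : LoopBound L V y κ w) (hW' : LoopBound L V (y + v) κ w) (m : Matrix n n ℂ) :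
    spreadMap L V (y + v) κ hw hW' m = spreadMap L V y κ hw hW m := by
  rw [spreadMap_apply, spreadMap_apply, spreadLift_bondDir_shift hL y v κ m hVv, smul_add, pushDir_shift L hVv]

/-- The bondwise inverses of `c` and `c + v` coincide for `L•v`-invariant `V`. [folklore] -/
theorem invData_shift {φ : Site d → Fin d → Matrix n n ℂ} (y v : Site d) (κ : Fin d)
    (hVv : ∀ (x : Site d) (μ : Fin d), V (x + (L : ℤ) • v) μ = V x μ) (hφ : φ (y + v) κ = φ y κ) :
    invData hL hV ha h512 hVa φ (y + v) κ = invData hL hV ha h512 hVa φ y κ := by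
  simp only [invData]
  set M := spreadInv hL hV ha hVa (small128_of_small512 ha h512) y κ (loopRad_le h512)
    (loopBound_of_smallField hL hV ha h512 hVa y κ) (φ y κ) with hM
  have h1 : spreadMap L V (y + v) κ (loopRad_le h512) (loopBound_of_smallField hL hV ha h512 hVa (y + v) κ) M = φ (y + v) κ := by
    rw [spreadMap_shift hL y v κ hVv _ (loopBound_of_smallField hL hV ha h512 hVa y κ), hM, spreadMap_spreadInv, hφ]
  rw [← h1, spreadInv_spreadMap]

/-- **PERIODICITY**: for `V` of period `L·M` and coarse data of period `M`, `Q_V φ` has period `L·M`. [folklore] -/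
theorem isPeriodicDir_spreadInverse {M : ℕ} (hVP : IsPeriodicCfg V ((L : ℤ) * M)) {φ : Site d → Fin d → Matrix n n ℂ}
    (hφ : ∀ (y : Site d) (j κ : Fin d), φ (y + (M : ℤ) • e j) κ = φ y κ) :
    IsPeriodicDir (spreadInverse hL hV ha h512 hVa φ) ((L : ℤ) * M) := by
  intro z j i
  have hVv : ∀ (x : Site d) (μ : Fin d), V (x + (L : ℤ) • ((M : ℤ) • e j)) μ = V x μ := fun x μ => by
    rw [smul_smul]; exact hVP x j μ
  rw [spreadInverse_apply]
  simp only [spreadLift]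
  have hcross : IsCross L (z + ((L : ℤ) * M) • e j) i ↔ IsCross L z i := by
    unfold IsCross; rw [cmod_add_period]
  by_cases hc : IsCross L z i
  · rw [if_pos hc, if_pos (hcross.mpr hc), cdiv_add_period hL,
      invData_shift hL hV ha h512 hVa (cdiv L z) ((M : ℤ) • e j) i hVv (hφ _ j i)]
    congr 2
    unfold crossHol exitCorner
    rw [cdiv_add_period hL]
    have e1 : (L : ℤ) • (cdiv L z + (M : ℤ) • e j + e i) = (L : ℤ) • (cdiv L z + e i) + (L : ℤ) • ((M : ℤ) • e j) := by
      rw [smul_add, smul_add, smul_add]; abel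
    have e2 : z + ((L : ℤ) * M) • e j + e i - ((L : ℤ) • (cdiv L z + e i) + (L : ℤ) • ((M : ℤ) • e j))
        = z + e i - (L : ℤ) • (cdiv L z + e i) := by rw [smul_smul]; abel
    rw [e1, e2]
    exact hol_shift (W := V) (W' := V) hVv _ _
  · rw [if_neg hc, if_neg (fun h => hc (hcross.mp h))]

end Inverse

/-! ## §4 Period sums: the exact volume factor `L^{d−1}` -/

omit [Fintype n] [DecidableEq n] in
/-- The number of block offsets with a prescribed coordinate: `#{r ∈ [0,L)^d : r_i = c} = L^{d−1}`. [folklore] -/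
theorem card_filter_coord_eq (L : ℕ) (i : Fin d) (c : Fin L) :
    (Finset.univ.filter fun r : Fin d → Fin L => r i = c).card = L ^ (d - 1) := by
  have h := Fintype.card_filter_piFinset_const_eq_of_mem (ι := Fin d) (Finset.univ : Finset (Fin L)) i (Finset.mem_univ c)
  rw [Fintype.piFinset_univ, Finset.card_univ, Fintype.card_fin, Fintype.card_fin] at h
  exact h

section Sums

variable [Nonempty n] {L : ℕ} (hL : 1 ≤ L) {V : Site d → Fin d → (Matrix n n ℂ)ˣ} (hV : IsUnitaryCfg V) {a : ℝ}
  (ha : 0 ≤ a) (h512 : 512 * (d + 1) * (d + 4) * (L : ℝ) ^ 2 * a ≤ 1) (hVa : SmallField V a)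

/-- One block: the `ℓ¹` mass of `Q_V φ` over the bonds starting in the block of `y` is at most `(1+128dL²a)·L^{d−1}·Σ_i ‖φ(y,i)‖`.
[folklore] -/
theorem sum_block_norm_spreadInverse_le (φ : Site d → Fin d → Matrix n n ℂ) (y : Site d) :
    ∑ r : Fin d → Fin L, ∑ i : Fin d, ‖spreadInverse hL hV ha h512 hVa φ ((L : ℤ) • y + boxVec L r) i‖
      ≤ (1 + 128 * (d * (L : ℝ) ^ 2 * a)) * (L : ℝ) ^ (d - 1) * ∑ i : Fin d, ‖φ y i‖ := by
  set C : ℝ := 1 + 128 * (d * (L : ℝ) ^ 2 * a) with hC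
  have hC0 : 0 ≤ C := by positivity
  rw [Finset.sum_comm, Finset.mul_sum]
  refine Finset.sum_le_sum fun i _ => ?_
  -- in direction `i` only the offsets with `r_i = L − 1` contribute, each at most `C‖φ(y,i)‖`
  have hpt : ∀ r : Fin d → Fin L, ‖spreadInverse hL hV ha h512 hVa φ ((L : ℤ) • y + boxVec L r) i‖
      ≤ if r i = ⟨L - 1, by omega⟩ then C * ‖φ y i‖ else 0 := by
    intro r
    split_ifs with h
    · have := norm_spreadInverse_le hL hV ha h512 hVa φ ((L : ℤ) • y + boxVec L r) i
      rwa [cdiv_smul_add_boxVec] at this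
    · rw [(crossSupported_spreadInverse hL hV ha h512 hVa φ) _ _ ?_, norm_zero]
      rw [isCross_smul_add_boxVec_iff]
      intro hc
      apply h
      apply Fin.ext
      simp only
      omega
  refine (Finset.sum_le_sum fun r _ => hpt r).trans ?_
  rw [Finset.sum_ite, Finset.sum_const_zero, add_zero, Finset.sum_const, card_filter_coord_eq, nsmul_eq_mul]
  push_cast
  nlinarith [norm_nonneg (φ y i), pow_nonneg (Nat.cast_nonneg L : (0 : ℝ) ≤ L) (d - 1)]

/-- **`ℓ¹` OVER ONE PERIOD**: `Σ_{z ∈ [0,LM)^d, i} ‖Q_V φ (z,i)‖ ≤ (1 + 128dL²a)·L^{d−1}·Σ_{y ∈ [0,M)^d, i} ‖φ(y,i)‖`.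
[folklore] -/
theorem dirL1_spreadInverse_le (φ : Site d → Fin d → Matrix n n ℂ) (M : ℕ) :
    dirL1 (spreadInverse hL hV ha h512 hVa φ) (periodBox (L * M))
      ≤ (1 + 128 * (d * (L : ℝ) ^ 2 * a)) * (L : ℝ) ^ (d - 1) * ∑ y ∈ periodBox M, ∑ i : Fin d, ‖φ y i‖ := by
  unfold T4AveragingDeficitWall.dirL1
  rw [← blockSites_periodBox L M hL, ← sum_blocks_eq L hL (periodBox M) (fun z => ∑ i : Fin d, ‖spreadInverse hL hV ha h512 hVa φ z i‖),
    Finset.mul_sum]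
  exact Finset.sum_le_sum fun y _ => sum_block_norm_spreadInverse_le hL hV ha h512 hVa φ y

/-- One block, squares. [folklore] -/
theorem sum_block_sq_spreadInverse_le (φ : Site d → Fin d → Matrix n n ℂ) (y : Site d) :
    ∑ r : Fin d → Fin L, ∑ i : Fin d, ‖spreadInverse hL hV ha h512 hVa φ ((L : ℤ) • y + boxVec L r) i‖ ^ 2
      ≤ (1 + 128 * (d * (L : ℝ) ^ 2 * a)) ^ 2 * (L : ℝ) ^ (d - 1) * ∑ i : Fin d, ‖φ y i‖ ^ 2 := by
  set C : ℝ := 1 + 128 * (d * (L : ℝ) ^ 2 * a) with hC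
  have hC0 : 0 ≤ C := by positivity
  rw [Finset.sum_comm, Finset.mul_sum]
  refine Finset.sum_le_sum fun i _ => ?_
  have hpt : ∀ r : Fin d → Fin L, ‖spreadInverse hL hV ha h512 hVa φ ((L : ℤ) • y + boxVec L r) i‖ ^ 2
      ≤ if r i = ⟨L - 1, by omega⟩ then C ^ 2 * ‖φ y i‖ ^ 2 else 0 := by
    intro r
    split_ifs with h
    · have h1 := norm_spreadInverse_le hL hV ha h512 hVa φ ((L : ℤ) • y + boxVec L r) i
      rw [cdiv_smul_add_boxVec] at h1
      rw [← mul_pow]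
      exact pow_le_pow_left₀ (norm_nonneg _) h1 2
    · rw [(crossSupported_spreadInverse hL hV ha h512 hVa φ) _ _ ?_, norm_zero, zero_pow two_ne_zero]
      rw [isCross_smul_add_boxVec_iff]
      intro hc
      apply h
      apply Fin.ext
      simp only
      omega
  refine (Finset.sum_le_sum fun r _ => hpt r).trans ?_
  rw [Finset.sum_ite, Finset.sum_const_zero, add_zero, Finset.sum_const, card_filter_coord_eq, nsmul_eq_mul]
  push_cast
  nlinarith [sq_nonneg (‖φ y i‖), pow_nonneg (Nat.cast_nonneg L : (0 : ℝ) ≤ L) (d - 1), sq_nonneg C]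

/-- **`ℓ²` OVER ONE PERIOD**: `Σ_{z ∈ [0,LM)^d, i} ‖Q_V φ (z,i)‖² ≤ (1 + 128dL²a)²·L^{d−1}·Σ_{y ∈ [0,M)^d, i} ‖φ(y,i)‖²`.
[folklore] -/
theorem dirSq_spreadInverse_le (φ : Site d → Fin d → Matrix n n ℂ) (M : ℕ) :
    dirSq (spreadInverse hL hV ha h512 hVa φ) (periodBox (L * M))
      ≤ (1 + 128 * (d * (L : ℝ) ^ 2 * a)) ^ 2 * (L : ℝ) ^ (d - 1) * ∑ y ∈ periodBox M, ∑ i : Fin d, ‖φ y i‖ ^ 2 := by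
  unfold T4AveragingDeficitWall.dirSq
  rw [← blockSites_periodBox L M hL, ← sum_blocks_eq L hL (periodBox M) (fun z => ∑ i : Fin d, ‖spreadInverse hL hV ha h512 hVa φ z i‖ ^ 2),
    Finset.mul_sum]
  exact Finset.sum_le_sum fun y _ => sum_block_sq_spreadInverse_le hL hV ha h512 hVa φ y

end Sums

end

end Summit.QuantumFields.BalabanUV.T4Continuum.SpreadLift
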